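import Literature.Analysis.FluidPDE.PlanarPwProfiles
import Literature.Analysis.FluidPDE.PlanarRunElement
import Literature.Analysis.FluidPDE.PlanarCornerElement
import Literature.Analysis.FluidPDE.PlanarShearedCornerElement
import Literature.Analysis.FluidPDE.PlanarConjElement
import HarnessLib

/-!
# Typed elements with rational data: runs and diagonal graph bands in the eight orientations

Topic `Literature/Analysis/FluidPDE`. Level-4 data model, part 2 (after `PlanarPwProfiles.lean`).
An element of an emitted phase of an explicit generator move is one of two types, each read through
one of the eight frames of the dihedral group `D₄` (`d4Frame : Fin 8 → LinFrame`, entries `0, ±1`):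

* a **run** `RunQ` — the x-graph band `runScalar` of `PlanarRunElement.lean` with transverse line
  `y(α)` (clock-affine) and material map `Ξ(α, ·) : Pw` (so stubs, rigid zones and breathing flex
  pieces are all runs; the gate squeeze is a run whose material map is pinned on the face);
* a **diagonal graph band** `DgQ` — the corner element `cornerScalar` of `PlanarCornerElement.lean`
  with profile `T(α, ·) : Pw` and material map `Ξ(α, ·) : Pw` (corners: a tent profile; births: a
  three-piece profile whose middle slope turns; in-place rescaling: a breathing `Ξ`),

all time dependence entering through one clock `clock t₀ τ` (`PlanarChainChecks.lean`). For the
clocked one-dimensional data (`Pw.cval`, `Pw.cdu`, `Pw.cdt`, `Pw.cduu`, `Pw.cdut`, `Pw.cprim`) the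
file proves the `HasDerivAt` web and joint smoothness; for each element type it defines the scalar,
the velocity and the stream function (with a stream offset `clockDeriv · (c_R(α) + c_K(α) K₂)`) and
proves, from the Boolean validity test `validB` (positive transition lengths, separated kinks, gap
slopes of `Ξ` in `[wlo, whi]` with `0 < wlo`) and the profile hypotheses: joint smoothness of scalar
and stream function, `velocity = ∇⊥ stream`, transport of the scalar by `∇⊥ stream` EVERYWHERE, the
bound `|Θ| ≤ M`, and containment of `{Θ ≠ 0}` in an explicit closed band — i.e. exactly the fields
of `ChainData.BandedFacts` (`PlanarBandedChain.lean`), elementwise. `ElemQ` is the sum of the two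
types with the common interface.

Folklore (explicit Eulerian kinematics); no named facts. Infrastructure towards a discharge of
`acm_compatible_blocks` (`QuasiSelfSimilarCompatibleBlocks.lean`).

## References

* G. Alberti, G. Crippa, A. L. Mazzucato, *Exponential self-similar mixing by incompressible
  flows*, J. Amer. Math. Soc. 32 (2019), 445–490, §§7–8 (arXiv:1605.02090).
-/

noncomputable section

open Function Set Filter
open scoped Topology ContDiff

namespace Literature.Analysis.FluidPDE

namespace PlanarKinematics

open Gluing

/-- The plane `ℝ²` as a Euclidean space. [folklore] -/
local notation "E²" => EuclideanSpace ℝ (Fin 2)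

/-! ## Clocked profiles -/

namespace Pw

variable {F : Pw}

/-- The mixed derivative: `∂ᵤ (∂_α F) = dαu`. [folklore] -/
theorem hasDerivAt_dα_u (hF : F.LenPos) (α u : ℝ) : HasDerivAt (F.dα α) (F.dαu α u) u := by
  have h1 : HasDerivAt (fun y => F.c.rate + F.s.rate * y) (F.s.rate) u := by
    simpa using ((hasDerivAt_id u).const_mul F.s.rate).const_add F.c.rate
  have h2 := hasDerivAt_list_sum F.kinks (f := fun k y => k.dα α y) (f' := fun k => k.dαu α u) fun k hk => by
    have hℓ : (k.ℓ : ℝ) ≠ 0 := (hF k hk).ne'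
    have ha : HasDerivAt (fun y => rampAt (k.b.eval α) k.ℓ y) (step ((u - k.b.eval α) / k.ℓ)) u :=
      hasDerivAt_rampAt hℓ u
    have hs : HasDerivAt (fun y => step ((y - k.b.eval α) / k.ℓ)) (deriv step ((u - k.b.eval α) / k.ℓ) / k.ℓ) u := by
      have h1 : HasDerivAt (fun y => (y - k.b.eval α) / k.ℓ) (1 / k.ℓ) u := by
        simpa using ((hasDerivAt_id u).sub_const (k.b.eval α)).div_const (k.ℓ : ℝ)
      have h2 : HasDerivAt step (deriv step ((u - k.b.eval α) / k.ℓ)) ((u - k.b.eval α) / k.ℓ) :=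
        (step_contDiff (n := 1)).differentiable one_ne_zero _ |>.hasDerivAt
      have h := h2.comp u h1
      refine h.congr_deriv ?_
      ring
    have h : HasDerivAt (fun y => k.J.rate * rampAt (k.b.eval α) k.ℓ y -
        k.J.eval α * k.b.rate * step ((y - k.b.eval α) / k.ℓ))
        (k.J.rate * step ((u - k.b.eval α) / k.ℓ) - k.J.eval α * k.b.rate * (deriv step ((u - k.b.eval α) / k.ℓ) / k.ℓ)) u :=
      (ha.const_mul k.J.rate).sub (hs.const_mul (k.J.eval α * k.b.rate))
    exact h
  exact h1.add h2

variable (F) (t₀ τ : ℝ)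

/-- Clocked value `Ξ(t, u) = F(clock t, u)`. [folklore] -/
def cval (t u : ℝ) : ℝ := F.val (clock t₀ τ t) u

/-- Clocked `∂ᵤ`. [folklore] -/
def cdu (t u : ℝ) : ℝ := F.du (clock t₀ τ t) u

/-- Clocked `∂ₜ = clock' · ∂_α`. [folklore] -/
def cdt (t u : ℝ) : ℝ := clockDeriv t₀ τ t * F.dα (clock t₀ τ t) u

/-- Clocked `∂ᵤ∂ᵤ`. [folklore] -/
def cduu (t u : ℝ) : ℝ := F.duu (clock t₀ τ t) u

/-- Clocked `∂ₜ∂ᵤ`. [folklore] -/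
def cdut (t u : ℝ) : ℝ := clockDeriv t₀ τ t * F.dαu (clock t₀ τ t) u

/-- Clocked antiderivative of `∂ₜ` in `u`: `clock' · dαPrim`. [folklore] -/
def cprim (t u : ℝ) : ℝ := clockDeriv t₀ τ t * F.dαPrim (clock t₀ τ t) u

variable {F t₀ τ}

/-- `∂ᵤ cval = cdu`. [folklore] -/
theorem hasDerivAt_cval_u (hF : F.LenPos) (t u : ℝ) : HasDerivAt (F.cval t₀ τ t) (F.cdu t₀ τ t u) u :=
  hasDerivAt_val_u hF _ u

/-- `∂ₜ cval = cdt`. [folklore] -/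
theorem hasDerivAt_cval_t (hF : F.LenPos) (hτ : τ ≠ 0) (t u : ℝ) :
    HasDerivAt (fun s => F.cval t₀ τ s u) (F.cdt t₀ τ t u) t := by
  have h := (hasDerivAt_val_α hF (clock t₀ τ t) u).comp t (hasDerivAt_clock t₀ hτ t)
  refine h.congr_deriv ?_
  rw [cdt, mul_comm]

/-- `∂ᵤ cdu = cduu`. [folklore] -/
theorem hasDerivAt_cdu_u (t u : ℝ) : HasDerivAt (F.cdu t₀ τ t) (F.cduu t₀ τ t u) u :=
  hasDerivAt_du_u _ u

/-- `∂ₜ cdu = cdut`. [folklore] -/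
theorem hasDerivAt_cdu_t (hτ : τ ≠ 0) (t u : ℝ) : HasDerivAt (fun s => F.cdu t₀ τ s u) (F.cdut t₀ τ t u) t := by
  have h := (hasDerivAt_du_α (F := F) (clock t₀ τ t) u).comp t (hasDerivAt_clock t₀ hτ t)
  refine h.congr_deriv ?_
  rw [cdut, mul_comm]

/-- `∂ᵤ cdt = cdut` (the mixed partial). [folklore] -/
theorem hasDerivAt_cdt_u (hF : F.LenPos) (t u : ℝ) : HasDerivAt (F.cdt t₀ τ t) (F.cdut t₀ τ t u) u :=
  (hasDerivAt_dα_u hF _ u).const_mul _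

/-- `∂ᵤ cprim = cdt`. [folklore] -/
theorem hasDerivAt_cprim_u (hF : F.LenPos) (t u : ℝ) : HasDerivAt (F.cprim t₀ τ t) (F.cdt t₀ τ t u) u :=
  (hasDerivAt_dαPrim_u hF _ u).const_mul _

/-- The clock map `(t, u) ↦ (clock t, u)` is smooth. [folklore] -/
theorem contDiff_clockPair (t₀ τ : ℝ) : ContDiff ℝ ∞ fun p : ℝ × ℝ => (clock t₀ τ p.1, p.2) :=
  ((clock_contDiff t₀ τ).comp contDiff_fst).prodMk contDiff_snd

/-- Joint smoothness of `cval`. [folklore] -/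
theorem contDiff_uncurry_cval : ContDiff ℝ ∞ (uncurry (F.cval t₀ τ)) := by
  have e : uncurry (F.cval t₀ τ) = (fun q : ℝ × ℝ => F.val q.1 q.2) ∘ fun p : ℝ × ℝ => (clock t₀ τ p.1, p.2) := rfl
  rw [e]; exact F.contDiff_val.comp (contDiff_clockPair t₀ τ)

/-- Joint smoothness of `cdu`. [folklore] -/
theorem contDiff_uncurry_cdu : ContDiff ℝ ∞ (uncurry (F.cdu t₀ τ)) := by
  have e : uncurry (F.cdu t₀ τ) = (fun q : ℝ × ℝ => F.du q.1 q.2) ∘ fun p : ℝ × ℝ => (clock t₀ τ p.1, p.2) := rfl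
  rw [e]; exact F.contDiff_du.comp (contDiff_clockPair t₀ τ)

/-- Joint smoothness of `cduu`. [folklore] -/
theorem contDiff_uncurry_cduu : ContDiff ℝ ∞ (uncurry (F.cduu t₀ τ)) := by
  have e : uncurry (F.cduu t₀ τ) = (fun q : ℝ × ℝ => F.duu q.1 q.2) ∘ fun p : ℝ × ℝ => (clock t₀ τ p.1, p.2) := rfl
  rw [e]; exact F.contDiff_duu.comp (contDiff_clockPair t₀ τ)

/-- Joint smoothness of `cdt`. [folklore] -/
theorem contDiff_uncurry_cdt (hτ : τ ≠ 0) : ContDiff ℝ ∞ (uncurry (F.cdt t₀ τ)) := by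
  have e : uncurry (F.cdt t₀ τ) = fun p : ℝ × ℝ =>
      clockDeriv t₀ τ p.1 * ((fun q : ℝ × ℝ => F.dα q.1 q.2) ∘ fun p : ℝ × ℝ => (clock t₀ τ p.1, p.2)) p := rfl
  rw [e]; exact ((clockDeriv_contDiff t₀ hτ).comp contDiff_fst).mul (F.contDiff_dα.comp (contDiff_clockPair t₀ τ))

/-- Joint smoothness of `cdut`. [folklore] -/
theorem contDiff_uncurry_cdut (hτ : τ ≠ 0) : ContDiff ℝ ∞ (uncurry (F.cdut t₀ τ)) := by
  have e : uncurry (F.cdut t₀ τ) = fun p : ℝ × ℝ =>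
      clockDeriv t₀ τ p.1 * ((fun q : ℝ × ℝ => F.dαu q.1 q.2) ∘ fun p : ℝ × ℝ => (clock t₀ τ p.1, p.2)) p := rfl
  rw [e]; exact ((clockDeriv_contDiff t₀ hτ).comp contDiff_fst).mul (F.contDiff_dαu.comp (contDiff_clockPair t₀ τ))

/-- Joint smoothness of `cprim`. [folklore] -/
theorem contDiff_uncurry_cprim (hτ : τ ≠ 0) : ContDiff ℝ ∞ (uncurry (F.cprim t₀ τ)) := by
  have e : uncurry (F.cprim t₀ τ) = fun p : ℝ × ℝ =>
      clockDeriv t₀ τ p.1 * ((fun q : ℝ × ℝ => F.dαPrim q.1 q.2) ∘ fun p : ℝ × ℝ => (clock t₀ τ p.1, p.2)) p := rfl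
  rw [e]; exact ((clockDeriv_contDiff t₀ hτ).comp contDiff_fst).mul (F.contDiff_dαPrim.comp (contDiff_clockPair t₀ τ))

/-- **Validity test of a material map**: positive lengths, separated kinks, gap slopes in
`[wlo, whi]`, `0 < wlo`. [folklore] -/
def matValidB (F : Pw) (wlo whi : ℚ) : Bool :=
  F.lenPosB && kinksSepB F.kinks && F.slopesInB wlo whi && decide (0 < wlo)

/-- A valid material map has positive lengths. [folklore] -/
theorem lenPos_of_matValidB {wlo whi : ℚ} (h : F.matValidB wlo whi = true) : F.LenPos := by
  simp only [matValidB, Bool.and_eq_true] at h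
  exact F.lenPos_of_lenPosB h.1.1.1

/-- **A valid material map has slope in `[wlo, whi]`** at every time. [folklore] -/
theorem cdu_mem_Icc {wlo whi : ℚ} (h : F.matValidB wlo whi = true) (t u : ℝ) :
    F.cdu t₀ τ t u ∈ Icc (wlo : ℝ) whi := by
  simp only [matValidB, Bool.and_eq_true] at h
  exact du_mem_Icc_of_checks h.1.1.1 h.1.1.2 h.1.2 (clock_mem_Icc t₀ τ t) u

/-- **A valid material map has positive slope** at every time. [folklore] -/
theorem cdu_pos {wlo whi : ℚ} (h : F.matValidB wlo whi = true) (t u : ℝ) : 0 < F.cdu t₀ τ t u := by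
  have hm := cdu_mem_Icc (t₀ := t₀) (τ := τ) h t u
  simp only [matValidB, Bool.and_eq_true, decide_eq_true_eq] at h
  have h0 : (0 : ℝ) < wlo := by exact_mod_cast h.2
  exact h0.trans_le hm.1

/-- A valid material map has nonvanishing slope. [folklore] -/
theorem cdu_ne_zero {wlo whi : ℚ} (h : F.matValidB wlo whi = true) (t u : ℝ) : F.cdu t₀ τ t u ≠ 0 :=
  (cdu_pos h t u).ne'

/-! ### Static profiles (time-independent data) -/

/-- **Static profile test**: every affine datum of `F` is constant in the clock. [folklore] -/
def staticB (F : Pw) : Bool :=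
  decide (F.c.v0 = F.c.v1) && decide (F.s.v0 = F.s.v1) &&
    F.kinks.all fun k => decide (k.b.v0 = k.b.v1) && decide (k.J.v0 = k.J.v1)

omit t₀ τ in
/-- A constant affine datum evaluates to its value at `0`. [folklore] -/
theorem _root_.Literature.Analysis.FluidPDE.PlanarKinematics.Aff.eval_eq_of_v0_eq_v1 {a : Aff} (h : a.v0 = a.v1)
    (α : ℝ) : a.eval α = a.eval 0 := by
  simp only [Aff.eval, h, sub_self, zero_mul, mul_zero]

/-- **A static profile does not depend on the clock** (value). [folklore] -/
theorem val_static (h : F.staticB = true) (α u : ℝ) : F.val α u = F.val 0 u := by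
  simp only [staticB, Bool.and_eq_true, decide_eq_true_eq, List.all_eq_true] at h
  obtain ⟨⟨hc, hs⟩, hk⟩ := h
  simp only [Pw.val]
  rw [Aff.eval_eq_of_v0_eq_v1 hc α, Aff.eval_eq_of_v0_eq_v1 hs α]
  congr 1
  refine congrArg List.sum (List.map_congr_left fun k hk' => ?_)
  obtain ⟨hb, hJ⟩ := hk k hk'
  simp only [Kink.val, Aff.eval_eq_of_v0_eq_v1 hb α, Aff.eval_eq_of_v0_eq_v1 hJ α]

/-- **A static profile does not depend on the clock** (slope). [folklore] -/
theorem du_static (h : F.staticB = true) (α u : ℝ) : F.du α u = F.du 0 u := by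
  simp only [staticB, Bool.and_eq_true, decide_eq_true_eq, List.all_eq_true] at h
  obtain ⟨⟨_, hs⟩, hk⟩ := h
  simp only [Pw.du]
  rw [Aff.eval_eq_of_v0_eq_v1 hs α]
  congr 1
  refine congrArg List.sum (List.map_congr_left fun k hk' => ?_)
  obtain ⟨hb, hJ⟩ := hk k hk'
  simp only [Kink.du, Kink.arg, Aff.eval_eq_of_v0_eq_v1 hb α, Aff.eval_eq_of_v0_eq_v1 hJ α]

/-- Clocked value of a static profile. [folklore] -/
theorem cval_static (h : F.staticB = true) (t u : ℝ) : F.cval t₀ τ t u = F.val 0 u := val_static h _ u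

/-- Clocked slope of a static profile. [folklore] -/
theorem cdu_static (h : F.staticB = true) (t u : ℝ) : F.cdu t₀ τ t u = F.du 0 u := du_static h _ u

/-- The frozen profile `F.val 0` is smooth. [folklore] -/
theorem contDiff_val_zero : ContDiff ℝ ∞ (F.val 0) :=
  F.contDiff_val.comp (contDiff_const.prodMk contDiff_id)

/-- The frozen slope `F.du 0` is smooth. [folklore] -/
theorem contDiff_du_zero : ContDiff ℝ ∞ (F.du 0) :=
  F.contDiff_du.comp (contDiff_const.prodMk contDiff_id)

end Pw

/-! ## Stream offsets -/

/-- **Stream offset** `c(t) = clock'(t) · (c_R(clock t) + c_K(clock t) · K₂)`. [folklore] -/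
def streamOffset (cR cK : Aff) (t₀ τ : ℝ) (t : ℝ) : ℝ :=
  clockDeriv t₀ τ t * (cR.eval (clock t₀ τ t) + cK.eval (clock t₀ τ t) * K₂)

/-- The stream offset is smooth. [folklore] -/
theorem streamOffset_contDiff (cR cK : Aff) (t₀ : ℝ) {τ : ℝ} (hτ : τ ≠ 0) : ContDiff ℝ ∞ (streamOffset cR cK t₀ τ) := by
  unfold streamOffset
  exact (clockDeriv_contDiff t₀ hτ).mul (((cR.contDiff_eval).comp (clock_contDiff t₀ τ)).add
    (((cK.contDiff_eval).comp (clock_contDiff t₀ τ)).mul contDiff_const))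

/-! ## The eight frames -/

/-- Entry `a` of the `D₄` frame with code `o`. [folklore] -/
def d4a (o : Fin 8) : ℤ := ![1, 1, -1, -1, 0, 0, 0, 0] o
/-- Entry `b` of the `D₄` frame with code `o`. [folklore] -/
def d4b (o : Fin 8) : ℤ := ![0, 0, 0, 0, -1, 1, -1, 1] o
/-- Entry `c` of the `D₄` frame with code `o`. [folklore] -/
def d4c (o : Fin 8) : ℤ := ![0, 0, 0, 0, -1, -1, 1, 1] o
/-- Entry `d` of the `D₄` frame with code `o`. [folklore] -/
def d4d (o : Fin 8) : ℤ := ![1, -1, 1, -1, 0, 0, 0, 0] o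

/-- The determinant of every `D₄` frame is `±1`, in particular nonzero. [folklore] -/
theorem d4_det_ne (o : Fin 8) : (d4a o : ℝ) * d4d o - d4b o * d4c o ≠ 0 := by
  fin_cases o <;> simp [d4a, d4b, d4c, d4d]

/-- **The `D₄` frame with code `o`**: `0` identity (corner E→S), `1` flipY (E→N), `2` flipX (W→S),
`3` rotation by `π` (W→N), `4` `(0,-1;-1,0)` (S→E), `5` `(0,1;-1,0)` (N→E), `6` `(0,-1;1,0)` (S→W),
`7` swap (N→W). [folklore] -/
def d4Frame (o : Fin 8) : LinFrame := ⟨d4a o, d4b o, d4c o, d4d o, d4_det_ne o⟩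

/-- Entries of the frame. [folklore] -/
@[simp] theorem d4Frame_a (o : Fin 8) : (d4Frame o).a = d4a o := rfl
/-- Entries of the frame. [folklore] -/
@[simp] theorem d4Frame_b (o : Fin 8) : (d4Frame o).b = d4b o := rfl
/-- Entries of the frame. [folklore] -/
@[simp] theorem d4Frame_c (o : Fin 8) : (d4Frame o).c = d4c o := rfl
/-- Entries of the frame. [folklore] -/
@[simp] theorem d4Frame_d (o : Fin 8) : (d4Frame o).d = d4d o := rfl

/-! ## Runs -/

/-- **Run data**: orientation code, transverse line `y` (frame coordinate `1`), material map `Ξ` in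
frame coordinate `0`, slope bounds `wlo, whi` for `Ξ`, stream offset coefficients. [folklore] -/
structure RunQ where
  /-- orientation code -/
  o : Fin 8
  /-- transverse line (clock-affine) -/
  y : Aff
  /-- material map -/
  Ξ : Pw
  /-- lower slope bound of `Ξ` -/
  wlo : ℚ
  /-- upper slope bound of `Ξ` -/
  whi : ℚ
  /-- stream offset, rational part -/
  cR : Aff
  /-- stream offset, `K₂` part -/
  cK : Aff
deriving DecidableEq, Inhabited

namespace RunQ

variable (r : RunQ) (t₀ τ : ℝ)

/-- The transverse line as a function of time. [folklore] -/
def yF (t : ℝ) : ℝ := r.y.eval (clock t₀ τ t)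

/-- Its time derivative. [folklore] -/
def y'F (t : ℝ) : ℝ := clockDeriv t₀ τ t * r.y.rate

/-- **Run scalar** (profile `G`). [folklore] -/
def scalar (G : ℝ → ℝ) : ℝ → E² → ℝ := (d4Frame r.o).conjScalar (runScalar G (r.yF t₀ τ) (r.Ξ.cdu t₀ τ))

/-- **Run velocity.** [folklore] -/
def velocity : ℝ → E² → E² :=
  (d4Frame r.o).conjVelocity (runVelocity (r.yF t₀ τ) (r.y'F t₀ τ) (r.Ξ.cdu t₀ τ) (r.Ξ.cdt t₀ τ)
    (r.Ξ.cduu t₀ τ) (r.Ξ.cdut t₀ τ))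

/-- **Run stream function** (with offset). [folklore] -/
def stream : ℝ → E² → ℝ := fun t z =>
  (d4Frame r.o).conjStream (runStream (r.yF t₀ τ) (r.y'F t₀ τ) (r.Ξ.cdu t₀ τ) (r.Ξ.cdt t₀ τ) fun _ => 0) t z +
    streamOffset r.cR r.cK t₀ τ t

/-- **Validity test** of a run. [folklore] -/
def validB (r : RunQ) : Bool := r.Ξ.matValidB r.wlo r.whi

variable {r t₀ τ}

/-- The transverse line is smooth. [folklore] -/
theorem yF_contDiff : ContDiff ℝ ∞ (r.yF t₀ τ) := (r.y.contDiff_eval).comp (clock_contDiff t₀ τ)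

/-- Its derivative is smooth. [folklore] -/
theorem y'F_contDiff (hτ : τ ≠ 0) : ContDiff ℝ ∞ (r.y'F t₀ τ) := (clockDeriv_contDiff t₀ hτ).mul contDiff_const

/-- The derivative of the transverse line. [folklore] -/
theorem hasDerivAt_yF (hτ : τ ≠ 0) (t : ℝ) : HasDerivAt (r.yF t₀ τ) (r.y'F t₀ τ t) t :=
  r.y.hasDerivAt_eval_comp (hasDerivAt_clock t₀ hτ t)

/-- **The run scalar is smooth.** [folklore] -/
theorem contDiff_uncurry_scalar {G : ℝ → ℝ} (hG : ContDiff ℝ ∞ G) (hv : r.validB = true) :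
    ContDiff ℝ ∞ (uncurry (r.scalar t₀ τ G)) :=
  (d4Frame r.o).contDiff_uncurry_conjScalar
    (contDiff_uncurry_runScalar hG yF_contDiff Pw.contDiff_uncurry_cdu fun t u => Pw.cdu_ne_zero hv t u)

/-- **The run stream function is smooth.** [folklore] -/
theorem contDiff_uncurry_stream (hτ : τ ≠ 0) (hv : r.validB = true) : ContDiff ℝ ∞ (uncurry (r.stream t₀ τ)) := by
  have hs : ContDiff ℝ ∞ (uncurry (runStream (r.yF t₀ τ) (r.y'F t₀ τ) (r.Ξ.cdu t₀ τ) (r.Ξ.cdt t₀ τ) fun _ => 0)) :=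
    contDiff_uncurry_runStream yF_contDiff (y'F_contDiff hτ) Pw.contDiff_uncurry_cdu (Pw.contDiff_uncurry_cdt hτ)
      contDiff_const fun t u => Pw.cdu_ne_zero hv t u
  have h := (d4Frame r.o).contDiff_uncurry_conjStream hs
  exact h.add ((streamOffset_contDiff r.cR r.cK t₀ hτ).comp contDiff_fst)

/-- **The run velocity is the perpendicular gradient of the run stream function.** [folklore] -/
theorem velocity_eq_perpGrad_stream (hτ : τ ≠ 0) (hv : r.validB = true) (t : ℝ) (z : E²) :
    r.velocity t₀ τ t z = perpGrad (r.stream t₀ τ t) z := by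
  have hF : r.Ξ.LenPos := Pw.lenPos_of_matValidB hv
  set w := (d4Frame r.o).app z with hw
  have hg : HasDerivAt (axialRate (r.Ξ.cdu t₀ τ) (r.Ξ.cdt t₀ τ) t)
      (axialRateDeriv (r.Ξ.cdu t₀ τ) (r.Ξ.cdt t₀ τ) (r.Ξ.cduu t₀ τ) (r.Ξ.cdut t₀ τ) t (w 0)) (w 0) :=
    hasDerivAt_axialRate (Pw.hasDerivAt_cdt_u hF t _) (Pw.hasDerivAt_cdu_u t _) (Pw.cdu_ne_zero hv t _)
  have hinner := runVelocity_eq_perpGrad_runStream (y := r.yF t₀ τ) (y' := r.y'F t₀ τ) (c := fun _ => (0 : ℝ))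
    (z := w) hg
  have hH : DifferentiableAt ℝ (runStream (r.yF t₀ τ) (r.y'F t₀ τ) (r.Ξ.cdu t₀ τ) (r.Ξ.cdt t₀ τ) (fun _ => 0) t) w := by
    have hs : ContDiff ℝ ∞ (uncurry (runStream (r.yF t₀ τ) (r.y'F t₀ τ) (r.Ξ.cdu t₀ τ) (r.Ξ.cdt t₀ τ) fun _ => 0)) :=
      contDiff_uncurry_runStream yF_contDiff (y'F_contDiff hτ) Pw.contDiff_uncurry_cdu (Pw.contDiff_uncurry_cdt hτ)
        contDiff_const fun t u => Pw.cdu_ne_zero hv t u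
    exact ((hs.contDiffAt (x := (t, w))).comp w (contDiffAt_const.prodMk contDiffAt_id)).differentiableAt (by simp)
  have hconj := (d4Frame r.o).conjVelocity_eq_perpGrad_conjStream hH hinner
  rw [velocity, hconj]
  have e : r.stream t₀ τ t = fun z' => (d4Frame r.o).conjStream
      (runStream (r.yF t₀ τ) (r.y'F t₀ τ) (r.Ξ.cdu t₀ τ) (r.Ξ.cdt t₀ τ) fun _ => 0) t z' + streamOffset r.cR r.cK t₀ τ t := rfl
  rw [e, perpGrad_add_const]

/-- **The run scalar is transported by the perpendicular gradient of its stream function**,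
everywhere. [folklore] -/
theorem transport {G : ℝ → ℝ} (hG : ContDiff ℝ ∞ G) (hτ : τ ≠ 0) (hv : r.validB = true) (t : ℝ) (z : E²) :
    deriv (fun s => r.scalar t₀ τ G s z) t + fderiv ℝ (r.scalar t₀ τ G t) z (perpGrad (r.stream t₀ τ t) z) = 0 := by
  have hF : r.Ξ.LenPos := Pw.lenPos_of_matValidB hv
  rw [← velocity_eq_perpGrad_stream hτ hv t z]
  set w := (d4Frame r.o).app z with hw
  have hGd : DifferentiableAt ℝ G ((w 1 - r.yF t₀ τ t) / r.Ξ.cdu t₀ τ t (w 0)) :=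
    (hG.differentiable (by simp)).differentiableAt
  have hinner := transport_runScalar (Gr := G) (y := r.yF t₀ τ) (Ξ := r.Ξ.cval t₀ τ) (Ξx := r.Ξ.cdu t₀ τ)
    (Ξt := r.Ξ.cdt t₀ τ) (Ξxx := r.Ξ.cduu t₀ τ) (Ξxt := r.Ξ.cdut t₀ τ) (z := w) hGd (hasDerivAt_yF hτ t)
    (Pw.hasDerivAt_cval_t hF hτ t _) (Pw.hasDerivAt_cval_u hF t _) (Pw.hasDerivAt_cdu_u t _)
    (Pw.hasDerivAt_cdu_t hτ t _) (Pw.cdu_ne_zero hv t _) (r.y'F t₀ τ) rfl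
  have hΘ : DifferentiableAt ℝ (runScalar G (r.yF t₀ τ) (r.Ξ.cdu t₀ τ) t) w := by
    have hs : ContDiff ℝ ∞ (uncurry (runScalar G (r.yF t₀ τ) (r.Ξ.cdu t₀ τ))) :=
      contDiff_uncurry_runScalar hG yF_contDiff Pw.contDiff_uncurry_cdu fun t u => Pw.cdu_ne_zero hv t u
    exact ((hs.contDiffAt (x := (t, w))).comp w (contDiffAt_const.prodMk contDiffAt_id)).differentiableAt (by simp)
  exact (d4Frame r.o).transport_conjScalar hΘ hinner

/-- **Bound.** [folklore] -/
theorem abs_scalar_le {G : ℝ → ℝ} {M : ℝ} (hM : ∀ q, |G q| ≤ M) (t : ℝ) (z : E²) : |r.scalar t₀ τ G t z| ≤ M :=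
  (d4Frame r.o).abs_conjScalar_le (abs_runScalar_le hM t) z

/-- **The band of a run**: `|(A z)₁ - y(t)| ≤ r₀ · whi` in space-time. [folklore] -/
def band (r : RunQ) (t₀ τ r₀ : ℝ) : Set (ℝ × E²) :=
  {p | |(d4Frame r.o).app p.2 1 - r.yF t₀ τ p.1| ≤ r₀ * r.whi}

/-- The band is closed. [folklore] -/
theorem isClosed_band (r₀ : ℝ) : IsClosed (r.band t₀ τ r₀) := by
  have h1 : Continuous fun p : ℝ × E² => (d4Frame r.o).app p.2 1 :=
    (EuclideanSpace.proj (1 : Fin 2)).continuous.comp ((d4Frame r.o).contDiff_app (n := 0)).continuous |>.comp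
      continuous_snd
  have h2 : Continuous fun p : ℝ × E² => r.yF t₀ τ p.1 :=
    (yF_contDiff (r := r) (t₀ := t₀) (τ := τ)).continuous.comp continuous_fst
  exact isClosed_le ((h1.sub h2).abs) continuous_const

/-- **Band containment**: if `G` vanishes off `(-r₀, r₀)`, the run scalar is nonzero only on the
band. [folklore] -/
theorem mem_band_of_scalar_ne_zero {G : ℝ → ℝ} {r₀ : ℝ} (hG0 : ∀ q, G q ≠ 0 → |q| < r₀) (hv : r.validB = true)
    {p : ℝ × E²} (hne : r.scalar t₀ τ G p.1 p.2 ≠ 0) : p ∈ r.band t₀ τ r₀ := by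
  have hm := Pw.cdu_mem_Icc (t₀ := t₀) (τ := τ) hv p.1 ((d4Frame r.o).app p.2 0)
  have h := abs_sub_lt_of_runScalar_ne_zero (Λ := (r.whi : ℝ)) hG0 (Pw.cdu_pos hv p.1 _) hm.2 hne
  exact h.le

end RunQ

/-! ## Diagonal graph bands -/

/-- **Diagonal graph band data**: orientation code, profile `T`, material map `Ξ` (both in the
frame abscissa `u`), slope bounds for `Ξ`, stream offset coefficients. [folklore] -/
structure DgQ where
  /-- orientation code -/
  o : Fin 8
  /-- displacement profile -/
  T : Pw
  /-- material map -/
  Ξ : Pw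
  /-- lower slope bound of `Ξ` -/
  wlo : ℚ
  /-- upper slope bound of `Ξ` -/
  whi : ℚ
  /-- stream offset, rational part -/
  cR : Aff
  /-- stream offset, `K₂` part -/
  cK : Aff
deriving DecidableEq, Inhabited

namespace DgQ

variable (d : DgQ) (t₀ τ : ℝ)

/-- The axial rate `g = -Ξₜ/Ξᵤ`. [folklore] -/
def g : ℝ → ℝ → ℝ := axialRate (d.Ξ.cdu t₀ τ) (d.Ξ.cdt t₀ τ)

/-- Its `u`-derivative. [folklore] -/
def gx : ℝ → ℝ → ℝ := axialRateDeriv (d.Ξ.cdu t₀ τ) (d.Ξ.cdt t₀ τ) (d.Ξ.cduu t₀ τ) (d.Ξ.cdut t₀ τ)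

/-- **Diagonal graph band, scalar** (profile `G`). [folklore] -/
def scalar (G : ℝ → ℝ) : ℝ → E² → ℝ :=
  (d4Frame d.o).conjScalar (cornerScalar G (d.T.cval t₀ τ) (d.Ξ.cval t₀ τ) (d.Ξ.cdu t₀ τ))

/-- **Diagonal graph band, velocity.** [folklore] -/
def velocity : ℝ → E² → E² :=
  (d4Frame d.o).conjVelocity (cornerVelocity (d.g t₀ τ) (d.gx t₀ τ) (d.T.cval t₀ τ) (d.T.cdt t₀ τ) (d.T.cdu t₀ τ))

/-- **Diagonal graph band, stream function** (with offset). [folklore] -/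
def stream : ℝ → E² → ℝ := fun t z =>
  (d4Frame d.o).conjStream (cornerStream (d.g t₀ τ) (d.T.cval t₀ τ) (d.T.cprim t₀ τ)) t z + streamOffset d.cR d.cK t₀ τ t

/-- **Validity test** of a diagonal graph band. [folklore] -/
def validB (d : DgQ) : Bool := d.Ξ.matValidB d.wlo d.whi && d.T.lenPosB

variable {d t₀ τ}

/-- Validity gives a valid material map. [folklore] -/
theorem matValid_of_validB (hv : d.validB = true) : d.Ξ.matValidB d.wlo d.whi = true := by
  simp only [validB, Bool.and_eq_true] at hv; exact hv.1

/-- Validity gives positive lengths of the profile. [folklore] -/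
theorem lenPosT_of_validB (hv : d.validB = true) : d.T.LenPos := by
  simp only [validB, Bool.and_eq_true] at hv; exact d.T.lenPos_of_lenPosB hv.2

/-- The axial rate is smooth. [folklore] -/
theorem contDiff_uncurry_g (hτ : τ ≠ 0) (hv : d.validB = true) : ContDiff ℝ ∞ (uncurry (d.g t₀ τ)) :=
  contDiff_uncurry_axialRate Pw.contDiff_uncurry_cdu (Pw.contDiff_uncurry_cdt hτ)
    fun t u => Pw.cdu_ne_zero (matValid_of_validB hv) t u

/-- Its derivative is smooth. [folklore] -/
theorem contDiff_uncurry_gx (hτ : τ ≠ 0) (hv : d.validB = true) : ContDiff ℝ ∞ (uncurry (d.gx t₀ τ)) :=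
  contDiff_uncurry_axialRateDeriv Pw.contDiff_uncurry_cdu (Pw.contDiff_uncurry_cdt hτ) Pw.contDiff_uncurry_cduu
    (Pw.contDiff_uncurry_cdut hτ) fun t u => Pw.cdu_ne_zero (matValid_of_validB hv) t u

/-- **The scalar is smooth.** [folklore] -/
theorem contDiff_uncurry_scalar {G : ℝ → ℝ} (hG : ContDiff ℝ ∞ G) (hv : d.validB = true) :
    ContDiff ℝ ∞ (uncurry (d.scalar t₀ τ G)) :=
  (d4Frame d.o).contDiff_uncurry_conjScalar
    (contDiff_uncurry_cornerScalar hG Pw.contDiff_uncurry_cval Pw.contDiff_uncurry_cval Pw.contDiff_uncurry_cdu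
      fun t u => Pw.cdu_ne_zero (matValid_of_validB hv) t u)

/-- **The stream function is smooth.** [folklore] -/
theorem contDiff_uncurry_stream (hτ : τ ≠ 0) (hv : d.validB = true) : ContDiff ℝ ∞ (uncurry (d.stream t₀ τ)) := by
  have hs : ContDiff ℝ ∞ (uncurry (cornerStream (d.g t₀ τ) (d.T.cval t₀ τ) (d.T.cprim t₀ τ))) :=
    contDiff_uncurry_cornerStream (contDiff_uncurry_g hτ hv) Pw.contDiff_uncurry_cval (Pw.contDiff_uncurry_cprim hτ)
  have h := (d4Frame d.o).contDiff_uncurry_conjStream hs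
  exact h.add ((streamOffset_contDiff d.cR d.cK t₀ hτ).comp contDiff_fst)

/-- **The velocity is the perpendicular gradient of the stream function.** [folklore] -/
theorem velocity_eq_perpGrad_stream (hτ : τ ≠ 0) (hv : d.validB = true) (t : ℝ) (z : E²) :
    d.velocity t₀ τ t z = perpGrad (d.stream t₀ τ t) z := by
  have hΞ : d.Ξ.LenPos := Pw.lenPos_of_matValidB (matValid_of_validB hv)
  have hT : d.T.LenPos := lenPosT_of_validB hv
  have hm := matValid_of_validB hv
  set w := (d4Frame d.o).app z with hw
  set u := (diagFrame w) 0 with hu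
  have hg : HasDerivAt (d.g t₀ τ t) (d.gx t₀ τ t u) u :=
    hasDerivAt_axialRate (Pw.hasDerivAt_cdt_u hΞ t _) (Pw.hasDerivAt_cdu_u t _) (Pw.cdu_ne_zero hm t _)
  have hinner := cornerVelocity_eq_perpGrad_cornerStream (g := d.g t₀ τ) (gx := d.gx t₀ τ) (T := d.T.cval t₀ τ)
    (Tt := d.T.cdt t₀ τ) (Tx := d.T.cdu t₀ τ) (P := d.T.cprim t₀ τ) (t := t) (z := w) hg
    (Pw.hasDerivAt_cval_u hT t _) (Pw.hasDerivAt_cprim_u hT t _)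
  have hH : DifferentiableAt ℝ (cornerStream (d.g t₀ τ) (d.T.cval t₀ τ) (d.T.cprim t₀ τ) t) w := by
    have hs : ContDiff ℝ ∞ (uncurry (cornerStream (d.g t₀ τ) (d.T.cval t₀ τ) (d.T.cprim t₀ τ))) :=
      contDiff_uncurry_cornerStream (contDiff_uncurry_g hτ hv) Pw.contDiff_uncurry_cval (Pw.contDiff_uncurry_cprim hτ)
    exact ((hs.contDiffAt (x := (t, w))).comp w (contDiffAt_const.prodMk contDiffAt_id)).differentiableAt (by simp)
  have hconj := (d4Frame d.o).conjVelocity_eq_perpGrad_conjStream hH hinner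
  rw [velocity, hconj]
  have e : d.stream t₀ τ t = fun z' => (d4Frame d.o).conjStream
      (cornerStream (d.g t₀ τ) (d.T.cval t₀ τ) (d.T.cprim t₀ τ)) t z' + streamOffset d.cR d.cK t₀ τ t := rfl
  rw [e, perpGrad_add_const]

/-- **The scalar is transported by the perpendicular gradient of its stream function**, everywhere.
[folklore] -/
theorem transport {G : ℝ → ℝ} (hG : ContDiff ℝ ∞ G) (hτ : τ ≠ 0) (hv : d.validB = true) (t : ℝ) (z : E²) :
    deriv (fun s => d.scalar t₀ τ G s z) t + fderiv ℝ (d.scalar t₀ τ G t) z (perpGrad (d.stream t₀ τ t) z) = 0 := by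
  have hΞ : d.Ξ.LenPos := Pw.lenPos_of_matValidB (matValid_of_validB hv)
  have hT : d.T.LenPos := lenPosT_of_validB hv
  have hm := matValid_of_validB hv
  rw [← velocity_eq_perpGrad_stream hτ hv t z]
  set w := (d4Frame d.o).app z with hw
  have hGd : DifferentiableAt ℝ G ((graphPullback (d.T.cval t₀ τ) (d.Ξ.cval t₀ τ) (d.Ξ.cdu t₀ τ) t (diagFrame w)) 1) :=
    (hG.differentiable (by simp)).differentiableAt
  have hinner := transport_cornerScalar (Gp := G) (T := d.T.cval t₀ τ) (Tt := d.T.cdt t₀ τ) (Tx := d.T.cdu t₀ τ)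
    (Ξ := d.Ξ.cval t₀ τ) (Ξx := d.Ξ.cdu t₀ τ) (Ξt := d.Ξ.cdt t₀ τ) (Ξxx := d.Ξ.cduu t₀ τ) (Ξxt := d.Ξ.cdut t₀ τ)
    (t := t) (z := w) hGd (Pw.hasDerivAt_cval_t hT hτ t _) (Pw.hasDerivAt_cval_u hT t _)
    (Pw.hasDerivAt_cval_t hΞ hτ t _) (Pw.hasDerivAt_cval_u hΞ t _) (Pw.hasDerivAt_cdu_u t _)
    (Pw.hasDerivAt_cdu_t hτ t _) (Pw.cdu_ne_zero hm t _)
  have hΘ : DifferentiableAt ℝ (cornerScalar G (d.T.cval t₀ τ) (d.Ξ.cval t₀ τ) (d.Ξ.cdu t₀ τ) t) w := by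
    have hs : ContDiff ℝ ∞ (uncurry (cornerScalar G (d.T.cval t₀ τ) (d.Ξ.cval t₀ τ) (d.Ξ.cdu t₀ τ))) :=
      contDiff_uncurry_cornerScalar hG Pw.contDiff_uncurry_cval Pw.contDiff_uncurry_cval Pw.contDiff_uncurry_cdu
        fun t u => Pw.cdu_ne_zero hm t u
    exact ((hs.contDiffAt (x := (t, w))).comp w (contDiffAt_const.prodMk contDiffAt_id)).differentiableAt (by simp)
  exact (d4Frame d.o).transport_conjScalar hΘ hinner

/-- **Bound.** [folklore] -/
theorem abs_scalar_le {G : ℝ → ℝ} {M : ℝ} (hM : ∀ q, |G q| ≤ M) (t : ℝ) (z : E²) : |d.scalar t₀ τ G t z| ≤ M :=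
  (d4Frame d.o).abs_conjScalar_le (fun w => by rw [cornerScalar_apply]; exact hM _) z

/-- **The band of a diagonal graph band**: `|v - T(t, u)| ≤ r₀ · whi` with `(u, v) = diagFrame (A z)`.
[folklore] -/
def band (d : DgQ) (t₀ τ r₀ : ℝ) : Set (ℝ × E²) :=
  {p | |(diagFrame ((d4Frame d.o).app p.2)) 1 - d.T.cval t₀ τ p.1 ((diagFrame ((d4Frame d.o).app p.2)) 0)| ≤ r₀ * d.whi}

/-- The band is closed. [folklore] -/
theorem isClosed_band (r₀ : ℝ) : IsClosed (d.band t₀ τ r₀) := by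
  have hA : Continuous fun p : ℝ × E² => diagFrame ((d4Frame d.o).app p.2) :=
    (contDiff_diagFrame (n := 0)).continuous.comp (((d4Frame d.o).contDiff_app (n := 0)).continuous.comp continuous_snd)
  have h1 : Continuous fun p : ℝ × E² => (diagFrame ((d4Frame d.o).app p.2)) 1 :=
    (EuclideanSpace.proj (1 : Fin 2)).continuous.comp hA
  have h0 : Continuous fun p : ℝ × E² => (diagFrame ((d4Frame d.o).app p.2)) 0 :=
    (EuclideanSpace.proj (0 : Fin 2)).continuous.comp hA
  have hc : Continuous (uncurry (d.T.cval t₀ τ)) := (Pw.contDiff_uncurry_cval (F := d.T) (t₀ := t₀) (τ := τ)).continuous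
  have h2 : Continuous fun p : ℝ × E² => d.T.cval t₀ τ p.1 ((diagFrame ((d4Frame d.o).app p.2)) 0) :=
    hc.comp₂ continuous_fst h0
  exact isClosed_le ((h1.sub h2).abs) continuous_const

/-- **Band containment**: if `G` vanishes off `(-r₀, r₀)`, the scalar is nonzero only on the band.
[folklore] -/
theorem mem_band_of_scalar_ne_zero {G : ℝ → ℝ} {r₀ : ℝ} (hG0 : ∀ q, G q ≠ 0 → |q| < r₀) (hv : d.validB = true)
    {p : ℝ × E²} (hne : d.scalar t₀ τ G p.1 p.2 ≠ 0) : p ∈ d.band t₀ τ r₀ := by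
  have hm := matValid_of_validB hv
  set w := (d4Frame d.o).app p.2 with hw
  have hval : d.scalar t₀ τ G p.1 p.2 =
      G (((diagFrame w) 1 - d.T.cval t₀ τ p.1 ((diagFrame w) 0)) / d.Ξ.cdu t₀ τ p.1 ((diagFrame w) 0)) := by
    rw [scalar, LinFrame.conjScalar_apply, cornerScalar, graphPullback_apply, vec2_apply_one]
  rw [hval] at hne
  have hq := hG0 _ hne
  have hpos := Pw.cdu_pos (t₀ := t₀) (τ := τ) hm p.1 ((diagFrame w) 0)
  have hle := (Pw.cdu_mem_Icc (t₀ := t₀) (τ := τ) hm p.1 ((diagFrame w) 0)).2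
  rw [abs_div, abs_of_pos hpos, div_lt_iff₀ hpos] at hq
  have hr : 0 ≤ r₀ := le_of_lt ((abs_nonneg _).trans_lt (hG0 _ hne))
  show |(diagFrame w) 1 - d.T.cval t₀ τ p.1 ((diagFrame w) 0)| ≤ r₀ * d.whi
  calc |(diagFrame w) 1 - d.T.cval t₀ τ p.1 ((diagFrame w) 0)|
      ≤ r₀ * d.Ξ.cdu t₀ τ p.1 ((diagFrame w) 0) := hq.le
    _ ≤ r₀ * d.whi := mul_le_mul_of_nonneg_left hle hr

end DgQ

/-! ## Sheared diagonal graph bands (`PlanarShearedCornerElement.lean`) -/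

/-- **A sheared diagonal graph band**: a diagonal graph band read with the constant shear `sh` of the
material abscissa (`ξ = u + sh (v - T(u))`); its profile `T` must be static. With `sh = ± 1/2` the
width transitions on the arm of frame slope `± 1` are unsheared. [folklore] -/
structure SDgQ where
  /-- the underlying diagonal graph band data (orientation, profile, material map, bounds, offsets) -/
  d : DgQ
  /-- the shear parameter -/
  sh : ℚ
deriving DecidableEq, Inhabited

namespace SDgQ

variable (e : SDgQ) (t₀ τ : ℝ)

/-- The static profile `T(u) = T.val 0 u`. [folklore] -/
def Tf : ℝ → ℝ := e.d.T.val 0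

/-- Its slope. [folklore] -/
def Tfx : ℝ → ℝ := e.d.T.du 0

/-- **Sheared diagonal graph band, scalar** (profile `G`). [folklore] -/
def scalar (G : ℝ → ℝ) : ℝ → E² → ℝ :=
  (d4Frame e.d.o).conjScalar (shCornerScalar G (e.sh : ℝ) e.Tf (e.d.Ξ.cval t₀ τ) (e.d.Ξ.cdu t₀ τ))

/-- **Sheared diagonal graph band, velocity.** [folklore] -/
def velocity : ℝ → E² → E² :=
  (d4Frame e.d.o).conjVelocity (shCornerVelocity (e.sh : ℝ) (e.d.g t₀ τ) (e.d.gx t₀ τ) e.Tf e.Tfx)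

/-- **Sheared diagonal graph band, stream function** (with offset). [folklore] -/
def stream : ℝ → E² → ℝ := fun t z =>
  (d4Frame e.d.o).conjStream (shCornerStream (e.sh : ℝ) (e.d.g t₀ τ) e.Tf) t z + streamOffset e.d.cR e.d.cK t₀ τ t

/-- **Geometric proxy, material profile**: the constant slope `whi` (the loose band of the sheared
element is the tight band of this profile). [folklore] -/
def geoXi (e : SDgQ) : Pw := ⟨Aff.const 0, Aff.const e.d.whi, []⟩

/-- **Geometric proxy**: the diagonal graph band with the same frame, profile, bounds and offsets and
the constant material slope `whi`; every GEOMETRIC statement about the sheared element is read on it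
(`PlanarTypedElements2.lean`, `PlanarTypedChain2.lean`). [folklore] -/
def geoDg (e : SDgQ) : DgQ := ⟨e.d.o, e.d.T, e.geoXi, e.d.whi, e.d.whi, e.d.cR, e.d.cK⟩

/-- **Validity test**: the underlying data are valid, the profile is static, and the geometric proxy
is valid (decidable on the data: `0 < whi`, the constant slope within its bounds). [folklore] -/
def validB (e : SDgQ) : Bool := e.d.validB && e.d.T.staticB && e.geoDg.validB

/-- The band (that of the underlying data; same profile and slope bounds). [folklore] -/
def band (e : SDgQ) (t₀ τ r₀ : ℝ) : Set (ℝ × E²) := e.d.band t₀ τ r₀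

variable {e t₀ τ}

/-- Validity of the underlying data. [folklore] -/
theorem validD_of_validB (hv : e.validB = true) : e.d.validB = true := by
  simp only [validB, Bool.and_eq_true] at hv; exact hv.1.1

/-- Static profile. [folklore] -/
theorem static_of_validB (hv : e.validB = true) : e.d.T.staticB = true := by
  simp only [validB, Bool.and_eq_true] at hv; exact hv.1.2

/-- Validity of the geometric proxy. [folklore] -/
theorem geoDg_validB_of_validB (hv : e.validB = true) : e.geoDg.validB = true := by
  simp only [validB, Bool.and_eq_true] at hv; exact hv.2

/-- The proxy profile has the constant slope `whi`. [folklore] -/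
@[simp] theorem geoXi_du (α u : ℝ) : e.geoXi.du α u = e.d.whi := by
  simp [geoXi, Pw.du, Aff.eval_const]

/-- The proxy profile has the constant clocked slope `whi`. [folklore] -/
@[simp] theorem geoXi_cdu (t u : ℝ) : e.geoXi.cdu t₀ τ t u = e.d.whi := by
  simp [Pw.cdu]

/-- Fields of the proxy. [folklore] -/
@[simp] theorem geoDg_o : e.geoDg.o = e.d.o := rfl
/-- Fields of the proxy. [folklore] -/
@[simp] theorem geoDg_T : e.geoDg.T = e.d.T := rfl
/-- Fields of the proxy. [folklore] -/
@[simp] theorem geoDg_Ξ : e.geoDg.Ξ = e.geoXi := rfl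
/-- Fields of the proxy. [folklore] -/
@[simp] theorem geoDg_whi : e.geoDg.whi = e.d.whi := rfl
/-- Fields of the proxy. [folklore] -/
@[simp] theorem geoDg_wlo : e.geoDg.wlo = e.d.whi := rfl

/-- **The loose band is the band of the geometric proxy.** [folklore] -/
theorem band_eq_geoDg_band (r₀ : ℝ) : e.band t₀ τ r₀ = e.geoDg.band t₀ τ r₀ := rfl

/-- The static profile is the clocked profile. [folklore] -/
theorem cval_T_eq_Tf (hv : e.validB = true) (t u : ℝ) : e.d.T.cval t₀ τ t u = e.Tf u :=
  Pw.cval_static (static_of_validB hv) t u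

/-- **The scalar is smooth.** [folklore] -/
theorem contDiff_uncurry_scalar {G : ℝ → ℝ} (hG : ContDiff ℝ ∞ G) (hv : e.validB = true) :
    ContDiff ℝ ∞ (uncurry (e.scalar t₀ τ G)) :=
  (d4Frame e.d.o).contDiff_uncurry_conjScalar
    (contDiff_uncurry_shCornerScalar hG Pw.contDiff_val_zero Pw.contDiff_uncurry_cval Pw.contDiff_uncurry_cdu
      fun t u => Pw.cdu_ne_zero (DgQ.matValid_of_validB (validD_of_validB hv)) t u)

/-- **The stream function is smooth.** [folklore] -/
theorem contDiff_uncurry_stream (hτ : τ ≠ 0) (hv : e.validB = true) : ContDiff ℝ ∞ (uncurry (e.stream t₀ τ)) := by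
  have hs : ContDiff ℝ ∞ (uncurry (shCornerStream (e.sh : ℝ) (e.d.g t₀ τ) e.Tf)) :=
    contDiff_uncurry_shCornerStream (DgQ.contDiff_uncurry_g hτ (validD_of_validB hv)) Pw.contDiff_val_zero
  have h := (d4Frame e.d.o).contDiff_uncurry_conjStream hs
  exact h.add ((streamOffset_contDiff e.d.cR e.d.cK t₀ hτ).comp contDiff_fst)

/-- **The velocity is the perpendicular gradient of the stream function.** [folklore] -/
theorem velocity_eq_perpGrad_stream (hτ : τ ≠ 0) (hv : e.validB = true) (t : ℝ) (z : E²) :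
    e.velocity t₀ τ t z = perpGrad (e.stream t₀ τ t) z := by
  have hvd := validD_of_validB hv
  have hΞ : e.d.Ξ.LenPos := Pw.lenPos_of_matValidB (DgQ.matValid_of_validB hvd)
  have hT : e.d.T.LenPos := DgQ.lenPosT_of_validB hvd
  have hm := DgQ.matValid_of_validB hvd
  set w := (d4Frame e.d.o).app z with hw
  set ξ := shAbscissa (e.sh : ℝ) e.Tf (diagFrame w) with hξ
  have hg : HasDerivAt (e.d.g t₀ τ t) (e.d.gx t₀ τ t ξ) ξ :=
    hasDerivAt_axialRate (Pw.hasDerivAt_cdt_u hΞ t _) (Pw.hasDerivAt_cdu_u t _) (Pw.cdu_ne_zero hm t _)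
  have hinner := shCornerVelocity_eq_perpGrad_shCornerStream (lam := (e.sh : ℝ)) (g := e.d.g t₀ τ) (gx := e.d.gx t₀ τ)
    (T := e.Tf) (Tx := e.Tfx) (t := t) (z := w) hg (Pw.hasDerivAt_val_u hT 0 _)
  have hH : DifferentiableAt ℝ (shCornerStream (e.sh : ℝ) (e.d.g t₀ τ) e.Tf t) w := by
    have hs : ContDiff ℝ ∞ (uncurry (shCornerStream (e.sh : ℝ) (e.d.g t₀ τ) e.Tf)) :=
      contDiff_uncurry_shCornerStream (DgQ.contDiff_uncurry_g hτ hvd) Pw.contDiff_val_zero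
    exact ((hs.contDiffAt (x := (t, w))).comp w (contDiffAt_const.prodMk contDiffAt_id)).differentiableAt (by simp)
  have hconj := (d4Frame e.d.o).conjVelocity_eq_perpGrad_conjStream hH hinner
  rw [velocity, hconj]
  have e' : e.stream t₀ τ t = fun z' => (d4Frame e.d.o).conjStream
      (shCornerStream (e.sh : ℝ) (e.d.g t₀ τ) e.Tf) t z' + streamOffset e.d.cR e.d.cK t₀ τ t := rfl
  rw [e', perpGrad_add_const]

/-- **The scalar is transported by the perpendicular gradient of its stream function**, everywhere.
[folklore] -/
theorem transport {G : ℝ → ℝ} (hG : ContDiff ℝ ∞ G) (hτ : τ ≠ 0) (hv : e.validB = true) (t : ℝ) (z : E²) :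
    deriv (fun s => e.scalar t₀ τ G s z) t + fderiv ℝ (e.scalar t₀ τ G t) z (perpGrad (e.stream t₀ τ t) z) = 0 := by
  have hvd := validD_of_validB hv
  have hΞ : e.d.Ξ.LenPos := Pw.lenPos_of_matValidB (DgQ.matValid_of_validB hvd)
  have hT : e.d.T.LenPos := DgQ.lenPosT_of_validB hvd
  have hm := DgQ.matValid_of_validB hvd
  rw [← velocity_eq_perpGrad_stream hτ hv t z]
  set w := (d4Frame e.d.o).app z with hw
  have hGd : DifferentiableAt ℝ G ((shGraphPullback (e.sh : ℝ) e.Tf (e.d.Ξ.cval t₀ τ) (e.d.Ξ.cdu t₀ τ) t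
      (diagFrame w)) 1) :=
    (hG.differentiable (by simp)).differentiableAt
  have hinner := transport_shCornerScalar (Gp := G) (lam := (e.sh : ℝ)) (T := e.Tf) (Tx := e.Tfx)
    (Ξ := e.d.Ξ.cval t₀ τ) (Ξx := e.d.Ξ.cdu t₀ τ) (Ξt := e.d.Ξ.cdt t₀ τ) (Ξxx := e.d.Ξ.cduu t₀ τ)
    (Ξxt := e.d.Ξ.cdut t₀ τ) (t := t) (z := w) hGd (Pw.hasDerivAt_val_u hT 0 _)
    (Pw.hasDerivAt_cval_t hΞ hτ t _) (Pw.hasDerivAt_cval_u hΞ t _) (Pw.hasDerivAt_cdu_u t _)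
    (Pw.hasDerivAt_cdu_t hτ t _) (Pw.cdu_ne_zero hm t _)
  have hΘ : DifferentiableAt ℝ (shCornerScalar G (e.sh : ℝ) e.Tf (e.d.Ξ.cval t₀ τ) (e.d.Ξ.cdu t₀ τ) t) w := by
    have hs : ContDiff ℝ ∞ (uncurry (shCornerScalar G (e.sh : ℝ) e.Tf (e.d.Ξ.cval t₀ τ) (e.d.Ξ.cdu t₀ τ))) :=
      contDiff_uncurry_shCornerScalar hG Pw.contDiff_val_zero Pw.contDiff_uncurry_cval Pw.contDiff_uncurry_cdu
        fun t u => Pw.cdu_ne_zero hm t u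
    exact ((hs.contDiffAt (x := (t, w))).comp w (contDiffAt_const.prodMk contDiffAt_id)).differentiableAt (by simp)
  exact (d4Frame e.d.o).transport_conjScalar hΘ hinner

/-- **Bound.** [folklore] -/
theorem abs_scalar_le {G : ℝ → ℝ} {M : ℝ} (hM : ∀ q, |G q| ≤ M) (t : ℝ) (z : E²) : |e.scalar t₀ τ G t z| ≤ M :=
  (d4Frame e.d.o).abs_conjScalar_le (fun w => by rw [shCornerScalar]; exact hM _) z

/-- **Closed band.** [folklore] -/
theorem isClosed_band (r₀ : ℝ) : IsClosed (e.band t₀ τ r₀) := DgQ.isClosed_band r₀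

/-- **Band containment**: if `G` vanishes off `(-r₀, r₀)`, the scalar is nonzero only on the band
(the transverse coordinate of the sheared band is that of the graph band; the profile is static).
[folklore] -/
theorem mem_band_of_scalar_ne_zero {G : ℝ → ℝ} {r₀ : ℝ} (hG0 : ∀ q, G q ≠ 0 → |q| < r₀) (hv : e.validB = true)
    {p : ℝ × E²} (hne : e.scalar t₀ τ G p.1 p.2 ≠ 0) : p ∈ e.band t₀ τ r₀ := by
  have hvd := validD_of_validB hv
  have hm := DgQ.matValid_of_validB hvd
  set w := (d4Frame e.d.o).app p.2 with hw
  set ξ := shAbscissa (e.sh : ℝ) e.Tf (diagFrame w) with hξ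
  have hval : e.scalar t₀ τ G p.1 p.2 =
      G (((diagFrame w) 1 - e.Tf ((diagFrame w) 0)) / e.d.Ξ.cdu t₀ τ p.1 ξ) := by
    rw [scalar, LinFrame.conjScalar_apply, shCornerScalar, shGraphPullback_apply, vec2_apply_one]
  rw [hval] at hne
  have hq := hG0 _ hne
  have hpos := Pw.cdu_pos (t₀ := t₀) (τ := τ) hm p.1 ξ
  have hle := (Pw.cdu_mem_Icc (t₀ := t₀) (τ := τ) hm p.1 ξ).2
  rw [abs_div, abs_of_pos hpos, div_lt_iff₀ hpos] at hq
  have hr : 0 ≤ r₀ := le_of_lt ((abs_nonneg _).trans_lt (hG0 _ hne))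
  show |(diagFrame w) 1 - e.d.T.cval t₀ τ p.1 ((diagFrame w) 0)| ≤ r₀ * e.d.whi
  rw [cval_T_eq_Tf hv]
  calc |(diagFrame w) 1 - e.Tf ((diagFrame w) 0)|
      ≤ r₀ * e.d.Ξ.cdu t₀ τ p.1 ξ := hq.le
    _ ≤ r₀ * e.d.whi := mul_le_mul_of_nonneg_left hle hr

end SDgQ

/-! ## Elements -/

/-- **A typed element**: a run or a diagonal graph band (the sheared bands `SDgQ` enter through the
wrapper type `ElemQ2` of `PlanarTypedElements2.lean`). [folklore] -/
inductive ElemQ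
  /-- a run -/
  | run (r : RunQ)
  /-- a diagonal graph band -/
  | dg (d : DgQ)
deriving DecidableEq, Inhabited

namespace ElemQ

variable (e : ElemQ) (t₀ τ : ℝ)

/-- Scalar of an element. [folklore] -/
def scalar (G : ℝ → ℝ) : ℝ → E² → ℝ :=
  match e with
  | run r => r.scalar t₀ τ G
  | dg d => d.scalar t₀ τ G

/-- Stream function of an element. [folklore] -/
def stream : ℝ → E² → ℝ :=
  match e with
  | run r => r.stream t₀ τ
  | dg d => d.stream t₀ τ

/-- Band of an element. [folklore] -/
def band (e : ElemQ) (t₀ τ r₀ : ℝ) : Set (ℝ × E²) :=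
  match e with
  | run r => r.band t₀ τ r₀
  | dg d => d.band t₀ τ r₀

/-- Validity test of an element. [folklore] -/
def validB (e : ElemQ) : Bool :=
  match e with
  | run r => r.validB
  | dg d => d.validB

variable {e t₀ τ}

/-- **Smooth scalar.** [folklore] -/
theorem contDiff_uncurry_scalar {G : ℝ → ℝ} (hG : ContDiff ℝ ∞ G) (hv : e.validB = true) :
    ContDiff ℝ ∞ (uncurry (e.scalar t₀ τ G)) := by
  cases e with
  | run r => exact RunQ.contDiff_uncurry_scalar hG hv
  | dg d => exact DgQ.contDiff_uncurry_scalar hG hv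

/-- **Smooth stream function.** [folklore] -/
theorem contDiff_uncurry_stream (hτ : τ ≠ 0) (hv : e.validB = true) : ContDiff ℝ ∞ (uncurry (e.stream t₀ τ)) := by
  cases e with
  | run r => exact RunQ.contDiff_uncurry_stream hτ hv
  | dg d => exact DgQ.contDiff_uncurry_stream hτ hv

/-- **Transport by the perpendicular gradient of the stream function, everywhere.** [folklore] -/
theorem transport {G : ℝ → ℝ} (hG : ContDiff ℝ ∞ G) (hτ : τ ≠ 0) (hv : e.validB = true) (t : ℝ) (z : E²) :
    deriv (fun s => e.scalar t₀ τ G s z) t + fderiv ℝ (e.scalar t₀ τ G t) z (perpGrad (e.stream t₀ τ t) z) = 0 := by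
  cases e with
  | run r => exact RunQ.transport hG hτ hv t z
  | dg d => exact DgQ.transport hG hτ hv t z

/-- **Bound.** [folklore] -/
theorem abs_scalar_le {G : ℝ → ℝ} {M : ℝ} (hM : ∀ q, |G q| ≤ M) (t : ℝ) (z : E²) : |e.scalar t₀ τ G t z| ≤ M := by
  cases e with
  | run r => exact RunQ.abs_scalar_le hM t z
  | dg d => exact DgQ.abs_scalar_le hM t z

/-- **Closed band.** [folklore] -/
theorem isClosed_band (r₀ : ℝ) : IsClosed (e.band t₀ τ r₀) := by
  cases e with
  | run r => exact RunQ.isClosed_band r₀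
  | dg d => exact DgQ.isClosed_band r₀

/-- **Band containment.** [folklore] -/
theorem mem_band_of_scalar_ne_zero {G : ℝ → ℝ} {r₀ : ℝ} (hG0 : ∀ q, G q ≠ 0 → |q| < r₀) (hv : e.validB = true)
    {p : ℝ × E²} (hne : e.scalar t₀ τ G p.1 p.2 ≠ 0) : p ∈ e.band t₀ τ r₀ := by
  cases e with
  | run r => exact RunQ.mem_band_of_scalar_ne_zero hG0 hv hne
  | dg d => exact DgQ.mem_band_of_scalar_ne_zero hG0 hv hne

end ElemQ

end PlanarKinematics

end Literature.Analysis.FluidPDE
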